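import Mathlib
import Summits.MatrixMultiplication.MatrixMultiplication.Theorems.SubgroupIdentityDesigns.Negative.CellStatus
import Summits.MatrixMultiplication.MatrixMultiplication.Theorems.SubgroupIdentityDesigns.Negative.NormOneTorusEnds
import Summits.MatrixMultiplication.MatrixMultiplication.Theorems.SubgroupIdentityDesigns.Negative.SingerWitness

/-!
# Status of the `(2,1)` cell: the landed exclusion list for a level-one witness, in one statement

Route `LevelGradedCohnUmans`, crux `SubgroupIdentityDesigns`, the `(m,k) = (2,1)` cell (`GL₂(𝔽_p)`,
level-`1` identity designs), `0 < ε ≤ 1`, `p ≥ 3`.  `levelOne_witness_status` assembles what the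
tree proves about a would-be witness `(H₁,H₂,H₃)` (subgroup TPP + level-`1` identity design + the
crux inequality `budget < (|H₁||H₂||H₃|)^{(2+ε)/3}`):
* `p ≥ 5` and every member is `p`-free (`CellStatus`);
* no member contains a conjugate of the Singer cycle `C_ns = {[[x, n y],[y, x]]}` (`SingerWitness`);
* no member contains a conjugate of `O₂⁻(𝔽_p) = SO(x² - n y²) ⋊ ⟨diag(1,-1)⟩` (`NormOneTorusEnds`).
Here `n` is any non-square of `𝔽_p`.  What is NOT excluded by a landed theorem: `p`-free triples all
of whose members avoid both kinds of subgroup (at `p = 5`: members of type `Z·2.S₄` or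
`Z·C₃·⟨u·Frob⟩`; for `p ≥ 7` none occurs in the census, but that is data, not a theorem).
VALUE = THEOREM, NOT summit progress; the crux item stmt-MatrixMultiplication-14079 is untouched and
remains open.
-/

set_option linter.dupNamespace false

noncomputable section

open scoped BigOperators Classical

open Summit.MatrixMultiplication.MatrixMultiplication.Theorems.LieRankDesigns.Negative
  (GLm Mat budget)

open Literature.Barriers.MatrixMultiplication (SubgroupTPP)

namespace Summit.MatrixMultiplication.MatrixMultiplication.Theorems.SubgroupIdentityDesigns.Negative

section WitnessStatus

variable {p : ℕ} [hp : Fact p.Prime]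

/-- **Status of the `(2,1)` cell.**  A level-one witness with `0 < ε ≤ 1`, `p ≥ 3` has `p ≥ 5`,
`p`-free members, no member containing a conjugate Singer cycle, and no member containing a
conjugate of `O₂⁻(𝔽_p)`. -/
theorem levelOne_witness_status (hp3 : 3 ≤ p) {ε : ℝ} (hε : 0 < ε) (hε1 : ε ≤ 1)
    {H₁ H₂ H₃ : Subgroup (GLm p 2)} (htpp : SubgroupTPP H₁ H₂ H₃)
    (hdesign : ∃ c : Mat p 2 → ℂ, (∀ M, 1 < M.rank → c M = 0) ∧
      (∑ M, c M * ZMod.stdAddChar (Matrix.trace (M * ((1 : GLm p 2) : Mat p 2)))) = 1 ∧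
      ∀ a ∈ H₁, ∀ b ∈ H₂, ∀ g ∈ H₃, a * b * g ≠ 1 →
        (∑ M, c M *
          ZMod.stdAddChar (Matrix.trace (M * ((a * b * g : GLm p 2) : Mat p 2)))) = 0)
    (hwit : budget p 2 1 (2 + ε) <
      ((Nat.card H₁ * Nat.card H₂ * Nat.card H₃ : ℕ) : ℝ) ^ ((2 + ε) / 3))
    (n : ZMod p) (hn : ∀ x : ZMod p, x * x ≠ n) :
    (5 ≤ p ∧ ¬ p ∣ Nat.card H₁ ∧ ¬ p ∣ Nat.card H₂ ∧ ¬ p ∣ Nat.card H₃) ∧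
    (∀ K : Subgroup (GLm p 2),
      (∀ k ∈ K, ((k : GLm p 2) : Mat p 2) 0 1 = n * ((k : GLm p 2) : Mat p 2) 1 0 ∧
        ((k : GLm p 2) : Mat p 2) 1 1 = ((k : GLm p 2) : Mat p 2) 0 0) →
      (∀ k : GLm p 2, (k : Mat p 2) 0 1 = n * (k : Mat p 2) 1 0 →
        (k : Mat p 2) 1 1 = (k : Mat p 2) 0 0 → k ∈ K) →
      ∀ x : GLm p 2, ¬ (∀ k ∈ K, x * k * x⁻¹ ∈ H₁) ∧ ¬ (∀ k ∈ K, x * k * x⁻¹ ∈ H₂) ∧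
        ¬ (∀ k ∈ K, x * k * x⁻¹ ∈ H₃)) ∧
    (∀ K : Subgroup (GLm p 2),
      (∀ k ∈ K, ((k : GLm p 2) : Mat p 2) 0 1 = n * ((k : GLm p 2) : Mat p 2) 1 0 ∧
        ((k : GLm p 2) : Mat p 2) 1 1 = ((k : GLm p 2) : Mat p 2) 0 0 ∧
        ((k : GLm p 2) : Mat p 2) 0 0 * ((k : GLm p 2) : Mat p 2) 0 0 -
          n * (((k : GLm p 2) : Mat p 2) 1 0 * ((k : GLm p 2) : Mat p 2) 1 0) = 1) →
      (∀ k : GLm p 2, (k : Mat p 2) 0 1 = n * (k : Mat p 2) 1 0 →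
        (k : Mat p 2) 1 1 = (k : Mat p 2) 0 0 →
        (k : Mat p 2) 0 0 * (k : Mat p 2) 0 0 - n * ((k : Mat p 2) 1 0 * (k : Mat p 2) 1 0) = 1 →
        k ∈ K) →
      ∀ x s : GLm p 2, (s : Mat p 2) 0 0 = 1 → (s : Mat p 2) 0 1 = 0 → (s : Mat p 2) 1 0 = 0 →
        (s : Mat p 2) 1 1 = -1 →
        ¬ ((∀ k ∈ K, x * k * x⁻¹ ∈ H₁) ∧ x * s * x⁻¹ ∈ H₁) ∧
        ¬ ((∀ k ∈ K, x * k * x⁻¹ ∈ H₂) ∧ x * s * x⁻¹ ∈ H₂) ∧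
        ¬ ((∀ k ∈ K, x * k * x⁻¹ ∈ H₃) ∧ x * s * x⁻¹ ∈ H₃)) := by
  have hp2 : p ≠ 2 := by omega
  have hε' : -2 < ε := by linarith
  refine ⟨levelOne_witness_pfree_profile hp3 hε hε1 htpp hdesign hwit,
    fun K hKshape hKall x => ⟨?_, ?_, ?_⟩,
    fun K hKshape hKall x s hs00 hs01 hs10 hs11 => ⟨?_, ?_, ?_⟩⟩
  · exact fun hKH => no_levelOne_witness_of_singer_member₁ hp3 hε' hε1 htpp hdesign hwit n hn K
      hKshape hKall x hKH
  · exact fun hKH => no_levelOne_witness_of_singer_member₂ hp3 hε' hε1 htpp hdesign hwit n hn K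
      hKshape hKall x hKH
  · exact fun hKH => no_levelOne_witness_of_singer_member₃ hp3 hε' hε1 htpp hdesign hwit n hn K
      hKshape hKall x hKH
  · exact fun h => no_levelOne_design_of_normOne_torus_conj₁ hp2 n hn K hKshape hKall x h.1 s h.2
      hs00 hs01 hs10 hs11 hdesign
  · exact fun h => no_levelOne_design_of_normOne_torus_conj₂ hp2 n hn K hKshape hKall x h.1 s h.2
      hs00 hs01 hs10 hs11 hdesign
  · exact fun h => no_levelOne_design_of_normOne_torus_conj₃ hp2 n hn K hKshape hKall x h.1 s h.2
      hs00 hs01 hs10 hs11 hdesign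

end WitnessStatus

end Summit.MatrixMultiplication.MatrixMultiplication.Theorems.SubgroupIdentityDesigns.Negative

end
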